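import Summits.QuantumFields.BalabanUV.Beta.GAN24.T2RecChargeStepFourFace
import Literature.MathematicalPhysics.QuantumFieldTheory.Balaban1983to89.Beta.PolarizationSign

/-!
# `BalabanUV.Beta.GAN24.CombChargeEvenClassPatterns` — binder row G-an2-4 ∕ (CONV-C), W-slot (α-0), ROW (C) AT LEVELS `≥ 1`, road-P2's JUNCTION BOOKKEEPING:
# **THE 40 EVEN-CLASS PATTERNS ARE THREE FAMILIES** — the (C)-binder `hZeven` of MY capstone `WrecAtEvenHalfRowsOfQLCEvenClasses` (the leg-summed bond-symmetrised
# charge conservation asked on the patterns with NO odd axis) follows from its ALL-EQUAL instances `(a,a;a,a)`, its DIAGONAL two-pair instances `(a,a;b,b)` and its CROSSED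
# two-pair instances `(a,b;a,b)` (`a ≠ b`) — the shape in which the (TL) programme's sector values arrive (memo `HOME/b2b-balaban-gan24-p2/gen48/JUNCTION-EVEN-CLASSES-g48.md`)
# (G-an2-4 CRUX TEAM (2), road-P2 chair `b2b-balaban-gan24-p2`, gen 48; journal [GAN24P2-G48-INTENT4])

NOT IN PRINT; OUR BOOKKEEPING ([folklore] finite case analysis on four indices; 0 `def`, 0 cited fact, 0 `def … : Prop`, 0 sorry).  HONEST FRAMING (cell contract,
verbatim): «discharging `BetaPertH` makes Bałaban's UV stability UNCONDITIONAL — a real constructive-QFT result; it is NOT the continuum limit and NOT the Clay problem.»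
HONEST DEPENDENCY (verbatim): «continuum YM on T⁴ ⇐ BetaPertH ∧ nine spine estimates (0/9 proved); BetaPertH ⇐ (D1) ∧ (D4) ∧ CAP+tail; G-an2-4 gates asym, D1 and NE2/3/4.»

WHY.  After g47's parity route (my `CombChargeParityOddLiteral` §3: the conservation display holds with both sides zero on the 216 ODD-AXIS patterns, `Odd Lc`, `2 ≤ N`)
the D1 literal's (C)-binder is displayed by my capstones on the EVEN CLASS only: `hZeven : ∀ l κ κ′ κ₁ κ₂, (¬ ∃ α, ε_κ ε_κ′ ε_κ₁ ε_κ₂ = −1) → LS_{l+2}(κ,κ′;κ₁,κ₂) = LS_{l+1}(κ,κ′;κ₁,κ₂)`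
(`ε_μ = reflSign α μ`, `LS_m` = the four-term leg-and-bond symmetrisation of `zmode Lc (unitS₂_m T̃_m) · · (inl ·) (inl ·)`).  The suppliers of the (TL) programme (leaf-06's
exchange sector, leaf-02's contact sectors, leaf-04's dead words) deliver VALUES per unordered pair `{a,b}`; this file is the pattern bookkeeping that lets road-P2's junction
file consume them by `exact`:
* §1 **`not_exists_reflSign_prod_eq_neg_one_iff`** (generic dimension): a pattern has NO axis of odd sign-product iff it is one of the three PAIRINGS
  `(κ = κ′ ∧ κ₁ = κ₂) ∨ (κ = κ₁ ∧ κ′ = κ₂) ∨ (κ = κ₂ ∧ κ′ = κ₁)` (at `d + 1 = 4`: the 36 two-pair and 4 all-equal patterns).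
* §2 **`evenClass_induction`** (generic): a predicate on patterns that is invariant under the bond swap `κ ↔ κ′` and the leg swap `κ₁ ↔ κ₂` holds on every even-class pattern
  as soon as it holds on `(a,a;a,a)`, on `(a,a;b,b)` and on `(a,b;a,b)` for `a ≠ b`.
* §2b **`families_of_flat_cov`** ∕ **`crossed_of_pair_cov`** (pure algebra, every hypothesis DISPLAYED): the three families from the flatness coefficients (FL: all-equal
  entries zero, `c_a²c_b²` coefficient zero), the transposition covariance of the diagonal entries (HC) and conservation of the crossed orbit sums — ONE value per pair, or ONE per
  level under pair covariance (leaf-02 g66 W-1 l.55477's reduction «22 → 1», with (HC) ∕ (FL) as letters at the `zmode` level — NOT transport lemmas: `Beta.CombPermutationWitness`).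
* §3 **`zsymLegSymEven_of_families`**: `hZeven` of `WrecAtEvenHalfRowsOfQLCEvenClasses.exists_allScalesSeq_JsRowD1Pin_of_QL_zsymLegSymEvenClasses` VERBATIM (generic colour
  constants, tables and root, as displayed there) ⟸ the three families `hW` (all-equal), `hY` (diagonal two-pair), `hX` (crossed two-pair) of the SAME equation.
* §4 **`zsymLegSymEven_of_flat_cov_crossed (hW0 hFL hHC hX)`**: the same `hZeven` ⟸ the three DISPLAYED zmode-level letters (all-equal charges zero, flatness coefficient zero,
  transposition covariance; every level `≥ 1`) ∧ conservation of the crossed orbit sums only.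
Discharges NOTHING of (C) on the even class (the families ∕ letters are hypotheses), nor (Q-L) ∕ (H1♮) ∕ (hW, hWall); asserts NO value of Bałaban's tables; NEVER «G-an2-4 closed»
as (CONV-C); NOT D1, NOT `BetaPertH`, NOT continuum, NOT Clay.  2026-08-23; no existing file touched.
-/

noncomputable section

open Finset
open scoped BigOperators
open Literature.MathematicalPhysics.QuantumFieldTheory
open Literature.MathematicalPhysics.QuantumFieldTheory.Balaban1983to89
open Literature.MathematicalPhysics.QuantumFieldTheory.Balaban1983to89.Beta
open ExpKernelCalculus (MKer)
open OneStepResolventKernel (Fib)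
open AffineAveraging (Site box toSite)
open AveragingMixedJetTables (mixFFAt)
open PolarizationSign (reflSign)
open Summit.QuantumFields.BalabanUV.Beta.SecondOrderUnits (unitS₂)
open Summit.QuantumFields.BalabanUV.Beta.SpineRooted (T2RecAt)
open Summit.QuantumFields.BalabanUV.Beta.GAN24.CombesThomas (sfStep smStep)
open Summit.QuantumFields.BalabanUV.Beta.GAN24.BiStencilZeroMode (Tab zmode)

namespace Summit.QuantumFields.BalabanUV.Beta.GAN24.CombChargeEvenClassPatterns

variable {d : ℕ}

/-! ## §1 The even class, counted: no odd axis ⟺ one of the three pairings -/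

/-- [folklore] `reflSign α α = −1`. -/
theorem reflSign_self (α : Fin (d + 1)) : reflSign α α = -1 := by
  simp [reflSign]

/-- [folklore] `reflSign α μ = 1` off the axis. -/
theorem reflSign_of_ne {α μ : Fin (d + 1)} (h : μ ≠ α) : reflSign α μ = 1 := by
  simp [reflSign, h]

/-- NOT IN PRINT; OUR BOOKKEEPING.  **THE EVEN CLASS, COUNTED**: a pattern `(κ, κ′; κ₁, κ₂)` admits NO axis `α` with `ε_κ ε_κ′ ε_κ₁ ε_κ₂ = −1` iff it is one of the three
pairings — bond-diagonal with leg-diagonal, or the two crossed ones (every direction then occurs an even number of times; at `d + 1 = 4` these are the 36 two-pair patterns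
and the 4 all-equal ones, the complement of g47's 216 odd-axis patterns). -/
theorem not_exists_reflSign_prod_eq_neg_one_iff (κ κ' κ₁ κ₂ : Fin (d + 1)) :
    (¬ ∃ α : Fin (d + 1), reflSign α κ * reflSign α κ' * reflSign α κ₁ * reflSign α κ₂ = -1) ↔
      ((κ = κ' ∧ κ₁ = κ₂) ∨ (κ = κ₁ ∧ κ' = κ₂) ∨ (κ = κ₂ ∧ κ' = κ₁)) := by
  constructor
  · intro h
    by_cases p1 : κ = κ' ∧ κ₁ = κ₂
    · exact Or.inl p1
    by_cases p2 : κ = κ₁ ∧ κ' = κ₂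
    · exact Or.inr (Or.inl p2)
    by_cases p3 : κ = κ₂ ∧ κ' = κ₁
    · exact Or.inr (Or.inr p3)
    have h1 : κ = κ' → κ₁ ≠ κ₂ := fun e n => p1 ⟨e, n⟩
    have h2 : κ = κ₁ → κ' ≠ κ₂ := fun e n => p2 ⟨e, n⟩
    have h3 : κ = κ₂ → κ' ≠ κ₁ := fun e n => p3 ⟨e, n⟩
    exfalso
    apply h
    by_cases e1 : κ = κ'
    · have n12 : κ₁ ≠ κ₂ := h1 e1
      by_cases e2 : κ₁ = κ
      · refine ⟨κ, ?_⟩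
        have e3 : κ₂ ≠ κ := fun h' => n12 (e2.trans h'.symm)
        rw [reflSign_self, show reflSign κ κ' = -1 from e1 ▸ reflSign_self κ, show reflSign κ κ₁ = -1 from e2 ▸ reflSign_self κ₁,
          reflSign_of_ne e3]
        norm_num
      · by_cases e3 : κ₂ = κ
        · refine ⟨κ, ?_⟩
          rw [reflSign_self, show reflSign κ κ' = -1 from e1 ▸ reflSign_self κ, reflSign_of_ne e2,
            show reflSign κ κ₂ = -1 from e3 ▸ reflSign_self κ₂]
          norm_num
        · refine ⟨κ₁, ?_⟩
          have n1 : κ ≠ κ₁ := fun h' => e2 h'.symm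
          have n2 : κ' ≠ κ₁ := fun h' => e2 (e1.trans h').symm
          have n3 : κ₂ ≠ κ₁ := fun h' => n12 h'.symm
          rw [reflSign_of_ne n1, reflSign_of_ne n2, reflSign_self, reflSign_of_ne n3]
          norm_num
    · by_cases e2 : κ₁ = κ
      · by_cases e3 : κ₂ = κ
        · refine ⟨κ, ?_⟩
          have n1 : κ' ≠ κ := fun h' => e1 h'.symm
          rw [reflSign_self, reflSign_of_ne n1, show reflSign κ κ₁ = -1 from e2 ▸ reflSign_self κ₁,
            show reflSign κ κ₂ = -1 from e3 ▸ reflSign_self κ₂]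
          norm_num
        · refine ⟨κ', ?_⟩
          have n24 : κ' ≠ κ₂ := h2 e2.symm
          have n1 : κ ≠ κ' := e1
          have n3 : κ₁ ≠ κ' := fun h' => e1 (e2.symm.trans h')
          have n4 : κ₂ ≠ κ' := fun h' => n24 h'.symm
          rw [reflSign_of_ne n1, reflSign_self, reflSign_of_ne n3, reflSign_of_ne n4]
          norm_num
      · by_cases e3 : κ₂ = κ
        · refine ⟨κ', ?_⟩
          have n23 : κ' ≠ κ₁ := h3 e3.symm
          have n1 : κ ≠ κ' := e1
          have n3 : κ₁ ≠ κ' := fun h' => n23 h'.symm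
          have n4 : κ₂ ≠ κ' := fun h' => e1 (e3.symm.trans h')
          rw [reflSign_of_ne n1, reflSign_self, reflSign_of_ne n3, reflSign_of_ne n4]
          norm_num
        · refine ⟨κ, ?_⟩
          have n1 : κ' ≠ κ := fun h' => e1 h'.symm
          rw [reflSign_self, reflSign_of_ne n1, reflSign_of_ne e2, reflSign_of_ne e3]
          norm_num
  · rintro hp ⟨α, hα⟩
    have sq : ∀ μ : Fin (d + 1), reflSign α μ * reflSign α μ = 1 := fun μ => by
      unfold reflSign; split_ifs <;> norm_num
    rcases hp with ⟨e1, e2⟩ | ⟨e1, e2⟩ | ⟨e1, e2⟩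
    · subst e1; subst e2
      have : reflSign α κ * reflSign α κ * reflSign α κ₁ * reflSign α κ₁ = 1 := by
        rw [sq, one_mul, sq]
      linarith
    · subst e1; subst e2
      have : reflSign α κ * reflSign α κ' * reflSign α κ * reflSign α κ' = 1 := by
        calc reflSign α κ * reflSign α κ' * reflSign α κ * reflSign α κ'
            = (reflSign α κ * reflSign α κ) * (reflSign α κ' * reflSign α κ') := by ring
          _ = 1 := by rw [sq, sq, one_mul]
      linarith
    · subst e1; subst e2
      have : reflSign α κ * reflSign α κ' * reflSign α κ' * reflSign α κ = 1 := by
        calc reflSign α κ * reflSign α κ' * reflSign α κ' * reflSign α κ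
            = (reflSign α κ * reflSign α κ) * (reflSign α κ' * reflSign α κ') := by ring
          _ = 1 := by rw [sq, sq, one_mul]
      linarith

/-! ## §2 Induction over the even class from three families -/

/-- NOT IN PRINT; OUR BOOKKEEPING.  **THREE FAMILIES EXHAUST THE EVEN CLASS**: a predicate on patterns that is stable under the bond swap `κ ↔ κ′` and under the leg swap
`κ₁ ↔ κ₂`, and that holds on the all-equal patterns `(a,a;a,a)`, on the diagonal two-pair patterns `(a,a;b,b)` and on the crossed two-pair patterns `(a,b;a,b)` (`a ≠ b`),
holds on every pattern with no odd axis. -/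
theorem evenClass_induction {E : Fin (d + 1) → Fin (d + 1) → Fin (d + 1) → Fin (d + 1) → Prop}
    (hEs : ∀ κ κ' κ₁ κ₂, E κ κ' κ₁ κ₂ → E κ' κ κ₁ κ₂) (hEl : ∀ κ κ' κ₁ κ₂, E κ κ' κ₁ κ₂ → E κ κ' κ₂ κ₁)
    (hW : ∀ a, E a a a a) (hY : ∀ a b, a ≠ b → E a a b b) (hX : ∀ a b, a ≠ b → E a b a b)
    (κ κ' κ₁ κ₂ : Fin (d + 1)) (heven : ¬ ∃ α : Fin (d + 1), reflSign α κ * reflSign α κ' * reflSign α κ₁ * reflSign α κ₂ = -1) :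
    E κ κ' κ₁ κ₂ := by
  have _ := hEs
  rw [not_exists_reflSign_prod_eq_neg_one_iff] at heven
  rcases heven with ⟨e1, e2⟩ | ⟨e1, e2⟩ | ⟨e1, e2⟩
  · subst e1; subst e2
    by_cases h : κ = κ₁
    · subst h; exact hW κ
    · exact hY κ κ₁ h
  · subst e1; subst e2
    by_cases h : κ = κ'
    · subst h; exact hW κ
    · exact hX κ κ' h
  · subst e1; subst e2
    by_cases h : κ = κ'
    · subst h; exact hW κ
    · exact hEl κ κ' κ κ' (hX κ κ' h)

/-! ## §2b Under DISPLAYED zero-mode symmetries: the three families from flatness (FL), pair covariance (HC) and ONE crossed value per pair -/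

section Algebra

variable {ι : Type*} {A B : ι → ι → ι → ι → ℝ}

/-- NOT IN PRINT; OUR BOOKKEEPING.  **THE THREE FAMILIES FROM (FL) ∧ (HC) ∧ THE CROSSED VALUES** (pure algebra on two pattern functions `A` = level `l+2`, `B` = level `l+1`
of the charge `zmode Lc (unitS₂_m T̃_m) κ κ′ (inl κ₁) (inl κ₂)`; every hypothesis DISPLAYED, nothing of Bałaban's asserted).  With, at both levels, the all-equal entries zero
(`hWA hWB` — flatness, the `c_a⁴` coefficient), the `c_a²c_b²` coefficient of the flatness polynomial zero (`hFA hFB`: diagonal + transposed diagonal + crossed orbit `= 0`) and the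
transposition covariance of the diagonal entries (`hHA hHB`: `(a,a;b,b) ↔ (b,b;a,a)`), conservation of the CROSSED orbit sums alone (`hX`) gives the three families of §2 ∕ §3 for
the leg-and-bond symmetrised equation `LS_A = LS_B`. -/
theorem families_of_flat_cov
    (hWA : ∀ a, A a a a a = 0) (hWB : ∀ a, B a a a a = 0)
    (hFA : ∀ a b, a ≠ b → A a a b b + A b b a a + (A a b a b + A b a a b + (A a b b a + A b a b a)) = 0)
    (hFB : ∀ a b, a ≠ b → B a a b b + B b b a a + (B a b a b + B b a a b + (B a b b a + B b a b a)) = 0)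
    (hHA : ∀ a b, A a a b b = A b b a a) (hHB : ∀ a b, B a a b b = B b b a a)
    (hX : ∀ a b, a ≠ b → A a b a b + A b a a b + (A a b b a + A b a b a) = B a b a b + B b a a b + (B a b b a + B b a b a)) :
    (∀ a, A a a a a + A a a a a + (A a a a a + A a a a a) = B a a a a + B a a a a + (B a a a a + B a a a a)) ∧
    (∀ a b, a ≠ b → A a a b b + A a a b b + (A a a b b + A a a b b) = B a a b b + B a a b b + (B a a b b + B a a b b)) ∧
    (∀ a b, a ≠ b → A a b a b + A b a a b + (A a b b a + A b a b a) = B a b a b + B b a a b + (B a b b a + B b a b a)) := by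
  refine ⟨fun a => by rw [hWA, hWB], fun a b hab => ?_, hX⟩
  have h1 := hFA a b hab
  have h2 := hFB a b hab
  have h3 := hHA a b
  have h4 := hHB a b
  have h5 := hX a b hab
  linarith

/-- NOT IN PRINT; OUR BOOKKEEPING.  **ONE CROSSED VALUE PER LEVEL under pair covariance**: if the crossed orbit sums do not depend on the (ordered, distinct) pair at either level
(`hPA hPB` — the hypercubic part of (HC), DISPLAYED) then conservation at ONE distinct pair `(i₀, i₁)` is conservation at every pair. -/
theorem crossed_of_pair_cov {i₀ i₁ : ι} (hi : i₀ ≠ i₁)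
    (hPA : ∀ a b c e, a ≠ b → c ≠ e → A a b a b + A b a a b + (A a b b a + A b a b a) = A c e c e + A e c c e + (A c e e c + A e c e c))
    (hPB : ∀ a b c e, a ≠ b → c ≠ e → B a b a b + B b a a b + (B a b b a + B b a b a) = B c e c e + B e c c e + (B c e e c + B e c e c))
    (h01 : A i₀ i₁ i₀ i₁ + A i₁ i₀ i₀ i₁ + (A i₀ i₁ i₁ i₀ + A i₁ i₀ i₁ i₀) = B i₀ i₁ i₀ i₁ + B i₁ i₀ i₀ i₁ + (B i₀ i₁ i₁ i₀ + B i₁ i₀ i₁ i₀)) :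
    ∀ a b, a ≠ b → A a b a b + A b a a b + (A a b b a + A b a b a) = B a b a b + B b a a b + (B a b b a + B b a b a) := by
  intro a b hab
  rw [hPA a b i₀ i₁ hab hi, hPB a b i₀ i₁ hab hi, h01]

end Algebra

/-! ## §3 At the capstone's display: `hZeven` from its three families -/

section Literal

variable {Lc : ℕ} [NeZero Lc] {r : Fin (3 + 1) → ℕ}

/-- NOT IN PRINT; OUR BOOKKEEPING.  **`hZeven` OF `WrecAtEvenHalfRowsOfQLCEvenClasses` FROM ITS THREE FAMILIES.**  The displayed (C)-binder of my capstone
`exists_allScalesSeq_JsRowD1Pin_of_QL_zsymLegSymEvenClasses` — the leg-summed bond-symmetrised conservation `LS_{l+2} = LS_{l+1}` on every pattern with no odd axis, generic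
colour constants `cE cVH cΛ cE₂ cB`, Wilson table `Tc`, border `vh₂S`, root `r` (VERBATIM shape) — follows from the same equation on the all-equal patterns (`hW`), on the
diagonal two-pair patterns (`hY`) and on the crossed two-pair patterns (`hX`): `LS` is symmetric under both swaps by construction.  The junction file of the (TL) programme
supplies `hW hY hX` per level from the sector values; nothing of them is asserted here. -/
theorem zsymLegSymEven_of_families (cE cVH cΛ cE₂ cB : ℝ) (Tc : Fin 4 → Fin 4 → Fin 4 → Fin 4 → ℝ)
    (vh₂S : Fin (3 + 1) → (Fin (3 + 1) → ℤ) → Fin (3 + 1) → (Fin (3 + 1) → ℤ) → MKer (3 + 1) (Fib 3))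
    (hW : ∀ (l : ℕ) (a : Fin (3 + 1)),
      zmode Lc (unitS₂ (sfStep Lc (l + 1 + 1)) (smStep 3 Lc (l + 1 + 1)) (T2RecAt 3 Lc (toSite r) cE cVH cΛ cE₂ cB Tc vh₂S (mixFFAt (toSite r) Lc) (l + 1 + 1))) a a (Sum.inl a) (Sum.inl a)
        + zmode Lc (unitS₂ (sfStep Lc (l + 1 + 1)) (smStep 3 Lc (l + 1 + 1)) (T2RecAt 3 Lc (toSite r) cE cVH cΛ cE₂ cB Tc vh₂S (mixFFAt (toSite r) Lc) (l + 1 + 1))) a a (Sum.inl a) (Sum.inl a)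
        + (zmode Lc (unitS₂ (sfStep Lc (l + 1 + 1)) (smStep 3 Lc (l + 1 + 1)) (T2RecAt 3 Lc (toSite r) cE cVH cΛ cE₂ cB Tc vh₂S (mixFFAt (toSite r) Lc) (l + 1 + 1))) a a (Sum.inl a) (Sum.inl a)
        + zmode Lc (unitS₂ (sfStep Lc (l + 1 + 1)) (smStep 3 Lc (l + 1 + 1)) (T2RecAt 3 Lc (toSite r) cE cVH cΛ cE₂ cB Tc vh₂S (mixFFAt (toSite r) Lc) (l + 1 + 1))) a a (Sum.inl a) (Sum.inl a))
      = zmode Lc (unitS₂ (sfStep Lc (l + 1)) (smStep 3 Lc (l + 1)) (T2RecAt 3 Lc (toSite r) cE cVH cΛ cE₂ cB Tc vh₂S (mixFFAt (toSite r) Lc) (l + 1))) a a (Sum.inl a) (Sum.inl a)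
        + zmode Lc (unitS₂ (sfStep Lc (l + 1)) (smStep 3 Lc (l + 1)) (T2RecAt 3 Lc (toSite r) cE cVH cΛ cE₂ cB Tc vh₂S (mixFFAt (toSite r) Lc) (l + 1))) a a (Sum.inl a) (Sum.inl a)
        + (zmode Lc (unitS₂ (sfStep Lc (l + 1)) (smStep 3 Lc (l + 1)) (T2RecAt 3 Lc (toSite r) cE cVH cΛ cE₂ cB Tc vh₂S (mixFFAt (toSite r) Lc) (l + 1))) a a (Sum.inl a) (Sum.inl a)
        + zmode Lc (unitS₂ (sfStep Lc (l + 1)) (smStep 3 Lc (l + 1)) (T2RecAt 3 Lc (toSite r) cE cVH cΛ cE₂ cB Tc vh₂S (mixFFAt (toSite r) Lc) (l + 1))) a a (Sum.inl a) (Sum.inl a)))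
    (hY : ∀ (l : ℕ) (a b : Fin (3 + 1)), a ≠ b →
      zmode Lc (unitS₂ (sfStep Lc (l + 1 + 1)) (smStep 3 Lc (l + 1 + 1)) (T2RecAt 3 Lc (toSite r) cE cVH cΛ cE₂ cB Tc vh₂S (mixFFAt (toSite r) Lc) (l + 1 + 1))) a a (Sum.inl b) (Sum.inl b)
        + zmode Lc (unitS₂ (sfStep Lc (l + 1 + 1)) (smStep 3 Lc (l + 1 + 1)) (T2RecAt 3 Lc (toSite r) cE cVH cΛ cE₂ cB Tc vh₂S (mixFFAt (toSite r) Lc) (l + 1 + 1))) a a (Sum.inl b) (Sum.inl b)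
        + (zmode Lc (unitS₂ (sfStep Lc (l + 1 + 1)) (smStep 3 Lc (l + 1 + 1)) (T2RecAt 3 Lc (toSite r) cE cVH cΛ cE₂ cB Tc vh₂S (mixFFAt (toSite r) Lc) (l + 1 + 1))) a a (Sum.inl b) (Sum.inl b)
        + zmode Lc (unitS₂ (sfStep Lc (l + 1 + 1)) (smStep 3 Lc (l + 1 + 1)) (T2RecAt 3 Lc (toSite r) cE cVH cΛ cE₂ cB Tc vh₂S (mixFFAt (toSite r) Lc) (l + 1 + 1))) a a (Sum.inl b) (Sum.inl b))
      = zmode Lc (unitS₂ (sfStep Lc (l + 1)) (smStep 3 Lc (l + 1)) (T2RecAt 3 Lc (toSite r) cE cVH cΛ cE₂ cB Tc vh₂S (mixFFAt (toSite r) Lc) (l + 1))) a a (Sum.inl b) (Sum.inl b)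
        + zmode Lc (unitS₂ (sfStep Lc (l + 1)) (smStep 3 Lc (l + 1)) (T2RecAt 3 Lc (toSite r) cE cVH cΛ cE₂ cB Tc vh₂S (mixFFAt (toSite r) Lc) (l + 1))) a a (Sum.inl b) (Sum.inl b)
        + (zmode Lc (unitS₂ (sfStep Lc (l + 1)) (smStep 3 Lc (l + 1)) (T2RecAt 3 Lc (toSite r) cE cVH cΛ cE₂ cB Tc vh₂S (mixFFAt (toSite r) Lc) (l + 1))) a a (Sum.inl b) (Sum.inl b)
        + zmode Lc (unitS₂ (sfStep Lc (l + 1)) (smStep 3 Lc (l + 1)) (T2RecAt 3 Lc (toSite r) cE cVH cΛ cE₂ cB Tc vh₂S (mixFFAt (toSite r) Lc) (l + 1))) a a (Sum.inl b) (Sum.inl b)))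
    (hX : ∀ (l : ℕ) (a b : Fin (3 + 1)), a ≠ b →
      zmode Lc (unitS₂ (sfStep Lc (l + 1 + 1)) (smStep 3 Lc (l + 1 + 1)) (T2RecAt 3 Lc (toSite r) cE cVH cΛ cE₂ cB Tc vh₂S (mixFFAt (toSite r) Lc) (l + 1 + 1))) a b (Sum.inl a) (Sum.inl b)
        + zmode Lc (unitS₂ (sfStep Lc (l + 1 + 1)) (smStep 3 Lc (l + 1 + 1)) (T2RecAt 3 Lc (toSite r) cE cVH cΛ cE₂ cB Tc vh₂S (mixFFAt (toSite r) Lc) (l + 1 + 1))) b a (Sum.inl a) (Sum.inl b)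
        + (zmode Lc (unitS₂ (sfStep Lc (l + 1 + 1)) (smStep 3 Lc (l + 1 + 1)) (T2RecAt 3 Lc (toSite r) cE cVH cΛ cE₂ cB Tc vh₂S (mixFFAt (toSite r) Lc) (l + 1 + 1))) a b (Sum.inl b) (Sum.inl a)
        + zmode Lc (unitS₂ (sfStep Lc (l + 1 + 1)) (smStep 3 Lc (l + 1 + 1)) (T2RecAt 3 Lc (toSite r) cE cVH cΛ cE₂ cB Tc vh₂S (mixFFAt (toSite r) Lc) (l + 1 + 1))) b a (Sum.inl b) (Sum.inl a))
      = zmode Lc (unitS₂ (sfStep Lc (l + 1)) (smStep 3 Lc (l + 1)) (T2RecAt 3 Lc (toSite r) cE cVH cΛ cE₂ cB Tc vh₂S (mixFFAt (toSite r) Lc) (l + 1))) a b (Sum.inl a) (Sum.inl b)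
        + zmode Lc (unitS₂ (sfStep Lc (l + 1)) (smStep 3 Lc (l + 1)) (T2RecAt 3 Lc (toSite r) cE cVH cΛ cE₂ cB Tc vh₂S (mixFFAt (toSite r) Lc) (l + 1))) b a (Sum.inl a) (Sum.inl b)
        + (zmode Lc (unitS₂ (sfStep Lc (l + 1)) (smStep 3 Lc (l + 1)) (T2RecAt 3 Lc (toSite r) cE cVH cΛ cE₂ cB Tc vh₂S (mixFFAt (toSite r) Lc) (l + 1))) a b (Sum.inl b) (Sum.inl a)
        + zmode Lc (unitS₂ (sfStep Lc (l + 1)) (smStep 3 Lc (l + 1)) (T2RecAt 3 Lc (toSite r) cE cVH cΛ cE₂ cB Tc vh₂S (mixFFAt (toSite r) Lc) (l + 1))) b a (Sum.inl b) (Sum.inl a)))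
    (l : ℕ) (κ κ' κ₁ κ₂ : Fin (3 + 1)) (heven : ¬ ∃ α : Fin 4, reflSign α κ * reflSign α κ' * reflSign α κ₁ * reflSign α κ₂ = -1) :
    zmode Lc (unitS₂ (sfStep Lc (l + 1 + 1)) (smStep 3 Lc (l + 1 + 1)) (T2RecAt 3 Lc (toSite r) cE cVH cΛ cE₂ cB Tc vh₂S (mixFFAt (toSite r) Lc) (l + 1 + 1))) κ κ' (Sum.inl κ₁) (Sum.inl κ₂)
        + zmode Lc (unitS₂ (sfStep Lc (l + 1 + 1)) (smStep 3 Lc (l + 1 + 1)) (T2RecAt 3 Lc (toSite r) cE cVH cΛ cE₂ cB Tc vh₂S (mixFFAt (toSite r) Lc) (l + 1 + 1))) κ' κ (Sum.inl κ₁) (Sum.inl κ₂)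
        + (zmode Lc (unitS₂ (sfStep Lc (l + 1 + 1)) (smStep 3 Lc (l + 1 + 1)) (T2RecAt 3 Lc (toSite r) cE cVH cΛ cE₂ cB Tc vh₂S (mixFFAt (toSite r) Lc) (l + 1 + 1))) κ κ' (Sum.inl κ₂) (Sum.inl κ₁)
        + zmode Lc (unitS₂ (sfStep Lc (l + 1 + 1)) (smStep 3 Lc (l + 1 + 1)) (T2RecAt 3 Lc (toSite r) cE cVH cΛ cE₂ cB Tc vh₂S (mixFFAt (toSite r) Lc) (l + 1 + 1))) κ' κ (Sum.inl κ₂) (Sum.inl κ₁))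
      = zmode Lc (unitS₂ (sfStep Lc (l + 1)) (smStep 3 Lc (l + 1)) (T2RecAt 3 Lc (toSite r) cE cVH cΛ cE₂ cB Tc vh₂S (mixFFAt (toSite r) Lc) (l + 1))) κ κ' (Sum.inl κ₁) (Sum.inl κ₂)
        + zmode Lc (unitS₂ (sfStep Lc (l + 1)) (smStep 3 Lc (l + 1)) (T2RecAt 3 Lc (toSite r) cE cVH cΛ cE₂ cB Tc vh₂S (mixFFAt (toSite r) Lc) (l + 1))) κ' κ (Sum.inl κ₁) (Sum.inl κ₂)
        + (zmode Lc (unitS₂ (sfStep Lc (l + 1)) (smStep 3 Lc (l + 1)) (T2RecAt 3 Lc (toSite r) cE cVH cΛ cE₂ cB Tc vh₂S (mixFFAt (toSite r) Lc) (l + 1))) κ κ' (Sum.inl κ₂) (Sum.inl κ₁)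
        + zmode Lc (unitS₂ (sfStep Lc (l + 1)) (smStep 3 Lc (l + 1)) (T2RecAt 3 Lc (toSite r) cE cVH cΛ cE₂ cB Tc vh₂S (mixFFAt (toSite r) Lc) (l + 1))) κ' κ (Sum.inl κ₂) (Sum.inl κ₁)) := by
  -- abbreviate the two members
  set A := zmode Lc (unitS₂ (sfStep Lc (l + 1 + 1)) (smStep 3 Lc (l + 1 + 1)) (T2RecAt 3 Lc (toSite r) cE cVH cΛ cE₂ cB Tc vh₂S (mixFFAt (toSite r) Lc) (l + 1 + 1))) with hA
  set B := zmode Lc (unitS₂ (sfStep Lc (l + 1)) (smStep 3 Lc (l + 1)) (T2RecAt 3 Lc (toSite r) cE cVH cΛ cE₂ cB Tc vh₂S (mixFFAt (toSite r) Lc) (l + 1))) with hB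
  refine evenClass_induction
    (E := fun κ κ' κ₁ κ₂ => A κ κ' (Sum.inl κ₁) (Sum.inl κ₂) + A κ' κ (Sum.inl κ₁) (Sum.inl κ₂) + (A κ κ' (Sum.inl κ₂) (Sum.inl κ₁) + A κ' κ (Sum.inl κ₂) (Sum.inl κ₁))
      = B κ κ' (Sum.inl κ₁) (Sum.inl κ₂) + B κ' κ (Sum.inl κ₁) (Sum.inl κ₂) + (B κ κ' (Sum.inl κ₂) (Sum.inl κ₁) + B κ' κ (Sum.inl κ₂) (Sum.inl κ₁)))
    ?_ ?_ (fun a => hW l a) (fun a b hab => hY l a b hab) (fun a b hab => hX l a b hab) κ κ' κ₁ κ₂ heven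
  · intro κ κ' κ₁ κ₂ h
    linarith [h]
  · intro κ κ' κ₁ κ₂ h
    linarith [h]


/-! ## §4 At the capstone's display: `hZeven` from flatness, transposition covariance and the crossed values (every symmetry DISPLAYED) -/

/-- NOT IN PRINT; OUR BOOKKEEPING.  **`hZeven` FROM (FL) ∧ (HC-transposition) ∧ THE CROSSED VALUES** — §2b's `families_of_flat_cov` read at the capstone's display and fed to §2:
with, at every level `m + 1` (all levels `≥ 1`), the all-equal charges zero (`hW0`), the `c_a²c_b²` flatness coefficient zero (`hFL`) and the transposition covariance of the
diagonal charges (`hHC`) — three DISPLAYED letters at the `zmode` level, whose discharge is the (TL) programme's (leaf-02's target T-W; NOT transport lemmas, cf.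
`Beta.CombPermutationWitness`) — the conservation of the CROSSED orbit sums (`hX`, one equation per ordered distinct pair and level) IS the whole even-class row `hZeven` of
`WrecAtEvenHalfRowsOfQLCEvenClasses.exists_allScalesSeq_JsRowD1Pin_of_QL_zsymLegSymEvenClasses` (VERBATIM shape, generic colour constants, tables and root). -/
theorem zsymLegSymEven_of_flat_cov_crossed (cE cVH cΛ cE₂ cB : ℝ) (Tc : Fin 4 → Fin 4 → Fin 4 → Fin 4 → ℝ)
    (vh₂S : Fin (3 + 1) → (Fin (3 + 1) → ℤ) → Fin (3 + 1) → (Fin (3 + 1) → ℤ) → MKer (3 + 1) (Fib 3))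
    (hW0 : ∀ (m : ℕ) (a : Fin (3 + 1)), zmode Lc (unitS₂ (sfStep Lc (m + 1)) (smStep 3 Lc (m + 1)) (T2RecAt 3 Lc (toSite r) cE cVH cΛ cE₂ cB Tc vh₂S (mixFFAt (toSite r) Lc) (m + 1))) a a (Sum.inl a) (Sum.inl a) = 0)
    (hFL : ∀ (m : ℕ) (a b : Fin (3 + 1)), a ≠ b →
      zmode Lc (unitS₂ (sfStep Lc (m + 1)) (smStep 3 Lc (m + 1)) (T2RecAt 3 Lc (toSite r) cE cVH cΛ cE₂ cB Tc vh₂S (mixFFAt (toSite r) Lc) (m + 1))) a a (Sum.inl b) (Sum.inl b) + zmode Lc (unitS₂ (sfStep Lc (m + 1)) (smStep 3 Lc (m + 1)) (T2RecAt 3 Lc (toSite r) cE cVH cΛ cE₂ cB Tc vh₂S (mixFFAt (toSite r) Lc) (m + 1))) b b (Sum.inl a) (Sum.inl a)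
        + (zmode Lc (unitS₂ (sfStep Lc (m + 1)) (smStep 3 Lc (m + 1)) (T2RecAt 3 Lc (toSite r) cE cVH cΛ cE₂ cB Tc vh₂S (mixFFAt (toSite r) Lc) (m + 1))) a b (Sum.inl a) (Sum.inl b) + zmode Lc (unitS₂ (sfStep Lc (m + 1)) (smStep 3 Lc (m + 1)) (T2RecAt 3 Lc (toSite r) cE cVH cΛ cE₂ cB Tc vh₂S (mixFFAt (toSite r) Lc) (m + 1))) b a (Sum.inl a) (Sum.inl b) + (zmode Lc (unitS₂ (sfStep Lc (m + 1)) (smStep 3 Lc (m + 1)) (T2RecAt 3 Lc (toSite r) cE cVH cΛ cE₂ cB Tc vh₂S (mixFFAt (toSite r) Lc) (m + 1))) a b (Sum.inl b) (Sum.inl a) + zmode Lc (unitS₂ (sfStep Lc (m + 1)) (smStep 3 Lc (m + 1)) (T2RecAt 3 Lc (toSite r) cE cVH cΛ cE₂ cB Tc vh₂S (mixFFAt (toSite r) Lc) (m + 1))) b a (Sum.inl b) (Sum.inl a))) = 0)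
    (hHC : ∀ (m : ℕ) (a b : Fin (3 + 1)), zmode Lc (unitS₂ (sfStep Lc (m + 1)) (smStep 3 Lc (m + 1)) (T2RecAt 3 Lc (toSite r) cE cVH cΛ cE₂ cB Tc vh₂S (mixFFAt (toSite r) Lc) (m + 1))) a a (Sum.inl b) (Sum.inl b) = zmode Lc (unitS₂ (sfStep Lc (m + 1)) (smStep 3 Lc (m + 1)) (T2RecAt 3 Lc (toSite r) cE cVH cΛ cE₂ cB Tc vh₂S (mixFFAt (toSite r) Lc) (m + 1))) b b (Sum.inl a) (Sum.inl a))
    (hX : ∀ (l : ℕ) (a b : Fin (3 + 1)), a ≠ b →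
      zmode Lc (unitS₂ (sfStep Lc (l + 1 + 1)) (smStep 3 Lc (l + 1 + 1)) (T2RecAt 3 Lc (toSite r) cE cVH cΛ cE₂ cB Tc vh₂S (mixFFAt (toSite r) Lc) (l + 1 + 1))) a b (Sum.inl a) (Sum.inl b) + zmode Lc (unitS₂ (sfStep Lc (l + 1 + 1)) (smStep 3 Lc (l + 1 + 1)) (T2RecAt 3 Lc (toSite r) cE cVH cΛ cE₂ cB Tc vh₂S (mixFFAt (toSite r) Lc) (l + 1 + 1))) b a (Sum.inl a) (Sum.inl b) + (zmode Lc (unitS₂ (sfStep Lc (l + 1 + 1)) (smStep 3 Lc (l + 1 + 1)) (T2RecAt 3 Lc (toSite r) cE cVH cΛ cE₂ cB Tc vh₂S (mixFFAt (toSite r) Lc) (l + 1 + 1))) a b (Sum.inl b) (Sum.inl a) + zmode Lc (unitS₂ (sfStep Lc (l + 1 + 1)) (smStep 3 Lc (l + 1 + 1)) (T2RecAt 3 Lc (toSite r) cE cVH cΛ cE₂ cB Tc vh₂S (mixFFAt (toSite r) Lc) (l + 1 + 1))) b a (Sum.inl b) (Sum.inl a))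
      = zmode Lc (unitS₂ (sfStep Lc (l + 1)) (smStep 3 Lc (l + 1)) (T2RecAt 3 Lc (toSite r) cE cVH cΛ cE₂ cB Tc vh₂S (mixFFAt (toSite r) Lc) (l + 1))) a b (Sum.inl a) (Sum.inl b) + zmode Lc (unitS₂ (sfStep Lc (l + 1)) (smStep 3 Lc (l + 1)) (T2RecAt 3 Lc (toSite r) cE cVH cΛ cE₂ cB Tc vh₂S (mixFFAt (toSite r) Lc) (l + 1))) b a (Sum.inl a) (Sum.inl b) + (zmode Lc (unitS₂ (sfStep Lc (l + 1)) (smStep 3 Lc (l + 1)) (T2RecAt 3 Lc (toSite r) cE cVH cΛ cE₂ cB Tc vh₂S (mixFFAt (toSite r) Lc) (l + 1))) a b (Sum.inl b) (Sum.inl a) + zmode Lc (unitS₂ (sfStep Lc (l + 1)) (smStep 3 Lc (l + 1)) (T2RecAt 3 Lc (toSite r) cE cVH cΛ cE₂ cB Tc vh₂S (mixFFAt (toSite r) Lc) (l + 1))) b a (Sum.inl b) (Sum.inl a)))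
    (l : ℕ) (κ κ' κ₁ κ₂ : Fin (3 + 1)) (heven : ¬ ∃ α : Fin 4, reflSign α κ * reflSign α κ' * reflSign α κ₁ * reflSign α κ₂ = -1) :
    zmode Lc (unitS₂ (sfStep Lc (l + 1 + 1)) (smStep 3 Lc (l + 1 + 1)) (T2RecAt 3 Lc (toSite r) cE cVH cΛ cE₂ cB Tc vh₂S (mixFFAt (toSite r) Lc) (l + 1 + 1))) κ κ' (Sum.inl κ₁) (Sum.inl κ₂)
        + zmode Lc (unitS₂ (sfStep Lc (l + 1 + 1)) (smStep 3 Lc (l + 1 + 1)) (T2RecAt 3 Lc (toSite r) cE cVH cΛ cE₂ cB Tc vh₂S (mixFFAt (toSite r) Lc) (l + 1 + 1))) κ' κ (Sum.inl κ₁) (Sum.inl κ₂)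
        + (zmode Lc (unitS₂ (sfStep Lc (l + 1 + 1)) (smStep 3 Lc (l + 1 + 1)) (T2RecAt 3 Lc (toSite r) cE cVH cΛ cE₂ cB Tc vh₂S (mixFFAt (toSite r) Lc) (l + 1 + 1))) κ κ' (Sum.inl κ₂) (Sum.inl κ₁)
        + zmode Lc (unitS₂ (sfStep Lc (l + 1 + 1)) (smStep 3 Lc (l + 1 + 1)) (T2RecAt 3 Lc (toSite r) cE cVH cΛ cE₂ cB Tc vh₂S (mixFFAt (toSite r) Lc) (l + 1 + 1))) κ' κ (Sum.inl κ₂) (Sum.inl κ₁))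
      = zmode Lc (unitS₂ (sfStep Lc (l + 1)) (smStep 3 Lc (l + 1)) (T2RecAt 3 Lc (toSite r) cE cVH cΛ cE₂ cB Tc vh₂S (mixFFAt (toSite r) Lc) (l + 1))) κ κ' (Sum.inl κ₁) (Sum.inl κ₂)
        + zmode Lc (unitS₂ (sfStep Lc (l + 1)) (smStep 3 Lc (l + 1)) (T2RecAt 3 Lc (toSite r) cE cVH cΛ cE₂ cB Tc vh₂S (mixFFAt (toSite r) Lc) (l + 1))) κ' κ (Sum.inl κ₁) (Sum.inl κ₂)
        + (zmode Lc (unitS₂ (sfStep Lc (l + 1)) (smStep 3 Lc (l + 1)) (T2RecAt 3 Lc (toSite r) cE cVH cΛ cE₂ cB Tc vh₂S (mixFFAt (toSite r) Lc) (l + 1))) κ κ' (Sum.inl κ₂) (Sum.inl κ₁)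
        + zmode Lc (unitS₂ (sfStep Lc (l + 1)) (smStep 3 Lc (l + 1)) (T2RecAt 3 Lc (toSite r) cE cVH cΛ cE₂ cB Tc vh₂S (mixFFAt (toSite r) Lc) (l + 1))) κ' κ (Sum.inl κ₂) (Sum.inl κ₁)) := by
  set A := zmode Lc (unitS₂ (sfStep Lc (l + 1 + 1)) (smStep 3 Lc (l + 1 + 1)) (T2RecAt 3 Lc (toSite r) cE cVH cΛ cE₂ cB Tc vh₂S (mixFFAt (toSite r) Lc) (l + 1 + 1))) with hA
  set B := zmode Lc (unitS₂ (sfStep Lc (l + 1)) (smStep 3 Lc (l + 1)) (T2RecAt 3 Lc (toSite r) cE cVH cΛ cE₂ cB Tc vh₂S (mixFFAt (toSite r) Lc) (l + 1))) with hB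
  obtain ⟨hWf, hYf, hXf⟩ := families_of_flat_cov
    (A := fun κ κ' κ₁ κ₂ => A κ κ' (Sum.inl κ₁) (Sum.inl κ₂)) (B := fun κ κ' κ₁ κ₂ => B κ κ' (Sum.inl κ₁) (Sum.inl κ₂))
    (fun a => hW0 (l + 1) a) (fun a => hW0 l a) (fun a b hab => hFL (l + 1) a b hab) (fun a b hab => hFL l a b hab)
    (fun a b => hHC (l + 1) a b) (fun a b => hHC l a b) (fun a b hab => hX l a b hab)
  exact evenClass_induction
    (E := fun κ κ' κ₁ κ₂ => A κ κ' (Sum.inl κ₁) (Sum.inl κ₂) + A κ' κ (Sum.inl κ₁) (Sum.inl κ₂) + (A κ κ' (Sum.inl κ₂) (Sum.inl κ₁) + A κ' κ (Sum.inl κ₂) (Sum.inl κ₁))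
      = B κ κ' (Sum.inl κ₁) (Sum.inl κ₂) + B κ' κ (Sum.inl κ₁) (Sum.inl κ₂) + (B κ κ' (Sum.inl κ₂) (Sum.inl κ₁) + B κ' κ (Sum.inl κ₂) (Sum.inl κ₁)))
    (fun κ κ' κ₁ κ₂ h => by linarith [h]) (fun κ κ' κ₁ κ₂ h => by linarith [h]) hWf hYf hXf κ κ' κ₁ κ₂ heven

end Literal

end Summit.QuantumFields.BalabanUV.Beta.GAN24.CombChargeEvenClassPatterns

end
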